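import Summits.BirchSwinnertonDyer.BirchSwinnertonDyer.Theorems.InertBadSignedBranchesInertBadAtThreeIstarZeroOfOddHeads
import Summits.BirchSwinnertonDyer.BirchSwinnertonDyer.Theorems.InertBadSignedBranchesPrintReadingsOfLiterature
import HarnessLib

/-!
# Route `InertBadSignedBranches` (rung K8), D71 child `InertBadAtThreeIstarZero`: the two ODD-`p`
# READING HEADS from NAMED LITERATURE FACTS, and the child modulo the law at `3`, (C1_η)@3 and
# published facts only (helper `--supports stmt-BirchSwinnertonDyer-19656`; cell `bsd-cm`, seat
# `bsd-cm-k8i-c41` gen 2; theorems only, nothing asserted)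

HONEST FRAMING (cell `bsd-cm`, `run/shared/lean/pub/bsd-cm/`): Birch–Swinnerton-Dyer is NOT proved
by any of this. The item `InertBadAtThreeIstarZero` — the `3`-part of the BSD formula for every
globally minimal CM curve `W/ℚ` of signed local type `(3, I₀*)` and analytic rank one — is OPEN in
print (η-branch `3`-adic Gross–Zagier law; J. Pan's 2017 thesis unpublished/unread; Tian, Proc. ICM
2022 p. 1993, attribution only). Every theorem below is CONDITIONAL on displayed hypotheses; the
class served (O10-PS@3, 57 classes `N < 5·10⁵`) stays CONSTRUCTION-SHAPED and OPEN; 0 definitions,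
0 named facts minted, 0 `sorry`; no label or mark moves.

PARTITION (D-0054): CornerF inert-bad (B12 / O10) × O10-PS@3 (57 rank-one classes of signed local
type `(3, I₀*)`) × `p = 3` — types-the-object-of; closes no cell, books nothing.

## What is new (gen 0 → gen 2 of this seat)

Gen 0 (p418040, p418240) left the child as «kernel modulo the law at `3` ∧ (C1_η)@3 ∧ the two
READING binders `hKO₃` / `h74X₃` (verbatim `W`-free print shapes) ∧ `PublishedFactsInert`», resp.
modulo the planner's three D79 reading HEADS (guard `p ≠ 2`). Since then the Literature homes of
the two printed theorems behind the readings landed (typer bsd-cm-k8i-ty: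
`KitajimaOtsuki2018.mainThm13_etaSignedSelmerDual_noFiniteSubmodule` p419137,
`Kobayashi2003.thm74_etaEvenMC_iff_etaOddMC` p419059 — both for every ODD `p` with `a_p = 0`) and
`Theorems/InertBadSignedBranchesPrintReadingsOfLiterature.lean` (p420699) made them texts. HERE:
* §1 — the two `W`-level odd-`p` reading HEADS, guard `p ≠ 2`, FROM THE NAMED FACTS:
  `StrictMinusNoFiniteSubmoduleOnType` DISCHARGED outright; `ExactReadingOnType` at each odd `p`
  modulo Kobayashi Thm. 7.4 at `η` (named fact) and (C1_η)-for-CM in Kobayashi's `K_∞`-form at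
  that `p` (`hC1K`; Pollack–Rubin's p. 448 REMARK — conjecture-grade by content, carried). ONE set
  of heads serves the `p ≥ 5` readings item 19226 (restriction) AND this child (instantiation at
  `3`) — the planner's D82 (b).
* §2 — the `p = 3` readings binder from the named facts + (C1_η)@3 in its two verbatim forms, and
  THE CHILD (fully-qualified route type) ⟸ the law at `3` (both kernel normal forms of record) ∧
  (C1_η)@3 [two forms] ∧ KO18 Main Thm. 1.3 ∧ Kob03 Thm. 7.4 (η) ∧ `PublishedFactsInert`; and gen
  0's odd-heads reduction with heads 2–3 discharged by name. Displayed and NOT in print remain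
  exactly: the law at `3` (the crux content) and (C1_η) (remark tier).

References (locators only): [Kobayashi2003] §4 (p. 8), Thm. 7.4 (p. 13); [KitajimaOtsuki2018] Main
Thm. 1.3 (= Thm. 4.8) with Def. 2.1; [PollackRubin2004] Theorem and remark (p. 448); [Mazur1978]
Cor. 4.1; [SilvermanATAEC1994] IV.9.4, Table 4.1; [Miller2011LMS] §1, Def. 1.1;
[Tian2023CongruentICM] p. 1993 (attribution only).
-/

set_option autoImplicit false
set_option linter.dupNamespace false

noncomputable section

open scoped Classical NumberField
open CongruenceSubgroup Field NumberField WeierstrassCurve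
open Literature.NumberTheory.EllipticCurves
open Literature.NumberTheory.EllipticCurves.ModularForms
open Literature.NumberTheory.EllipticCurves.Rank1Residual
open Literature.NumberTheory.EllipticCurves.Rank1Residual.Typed
open Literature.NumberTheory.GaloisRepresentations
open ZpExtension
open Summit.BirchSwinnertonDyer.Rank1Residual
open Summit.BirchSwinnertonDyer.Rank1Residual.Additive
open Summit.BirchSwinnertonDyer.Rank1Residual.Additive.LocalLog
open Summit.BirchSwinnertonDyer.Rank1Residual.X12.O10
open Summit.BirchSwinnertonDyer.BirchSwinnertonDyer.Theses.InertBadSignedBranches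
open Summit.BirchSwinnertonDyer.BirchSwinnertonDyer.Theorems.PrintReadingsOfLiterature

namespace Summit.BirchSwinnertonDyer.BirchSwinnertonDyer.Theorems

/-! ## §1 The two odd-`p` reading heads from the named Literature facts -/

/-- **Head `StrictMinusNoFiniteSubmoduleOnType` (guard `p ≠ 2`) DISCHARGED from the named fact
Kitajima–Otsuki 2018 Main Thm. 1.3** (η-part, sign `−`): for every odd `p` and every `W` of signed
local type `(p, I₀*)` with `r_an(W) = 1`, (R2) `OddBranchStrictMinusNoFiniteSubmoduleAt W p`. In fact
the typed reading holds for EVERY `(W, p)` modulo the fact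
(`PrintReadingsOfLiterature.oddBranchStrictMinusNoFiniteSubmoduleAt_of_kitajimaOtsuki`); the type /
rank hypotheses are the head's shape only. CONDITIONAL on the named fact.
[cite: KitajimaOtsuki2018, Main Thm. 1.3 (= Thm. 4.8) with Def. 2.1] [cite: Kobayashi2003, §4 (p. 8)] -/
theorem inertBadSignedBranches_oddHead_noFiniteSubmodule_of_kitajimaOtsuki13
    (hKO : KitajimaOtsuki2018.mainThm13_etaSignedSelmerDual_noFiniteSubmodule) :
    ∀ (p : ℕ) [Fact p.Prime], p ≠ 2 → ∀ (W : WeierstrassCurve ℚ) [W.IsElliptic]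
      [W.IsGloballyMinimal], HasSignedLocalType W p (.Istar 0) → W.analyticRank = 1 →
      OddBranchStrictMinusNoFiniteSubmoduleAt W p :=
  fun p _ _ W _ _ _ _ ↦ oddBranchStrictMinusNoFiniteSubmoduleAt_of_kitajimaOtsuki W p hKO

/-- **Head `ExactReadingOnType` AT ONE odd prime `p`, from the named fact Kobayashi 2003 Thm. 7.4 at
`η` and (C1_η)-for-CM in Kobayashi's `K_∞`-form at `p`.** Hypotheses: `h74` = the named fact (even
main conjecture at `η` on `X⁺(V/K_∞)^η` ⟺ odd main conjecture at `η` on `X⁻(V/K_∞)^η`, every odd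
`p`, `a_p(V) = 0`); `hC1K` = at THIS `p`, for every CM `V` good at `p` with `a_p(V) = 0`, the even
main conjecture at `η` on the `η`-component object (VERBATIM §4 p. 8; for CM `V` = Pollack–Rubin's
p. 448 REMARK — conjecture-grade by content, NOT a Literature fact; carried). Conclusion: Kobayashi
Thm. 7.4 (ii) EXACT on the type `(p, I₀*)` — for every `W` of the type with `r_an(W) = 1`, every
good `a_p = 0` twin `V = C • W^{(p*)}` with newform `f`, period scalar `ϖ`, minus branch
`L_η = X·L'`: `char 𝒳⁻_str(W) = (L')` on every strict-minus dual datum. Proof (the typer's §4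
argument at one `p`): the twin is CM (same `j`); Thm. 7.4 at `η` turns `hC1K` into the odd main
conjecture on `X⁻(V/K_∞)^η`, read on the strict-minus datum of `W` by x1b's dictionary
(`StrictSignedSelmerDualData.toEtaSigned`, `K₀ = ℚ(μ_p)`, `θ² = p*`, `γ ↦ γ' ∈ Gal(ℚ̄/K₀)`).
CONDITIONAL; the unused `QuadraticBranchPlusMainConjectureAt V p` binder is the head's shape.
[cite: Kobayashi2003, §4 (p. 8), Thm. 7.4 (p. 13)]
[cite: PollackRubin2004, Theorem and the remark on Sel over ℚ(μ_{p^∞}) (p. 448)] -/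
theorem inertBadSignedBranches_oddHead_exactReadingAt_of_kobayashi74_of_plusMCEtaK
    (p : ℕ) [Fact p.Prime] (hp2 : p ≠ 2) (h74 : Kobayashi2003.thm74_etaEvenMC_iff_etaOddMC)
    (hC1K : ∀ (K₀ : Type) [Field K₀] [NumberField K₀] [IsCyclotomicExtension {p} ℚ K₀]
        [(galRange (K := ℚ) K₀).Normal] (η : absoluteGaloisGroup ℚ →* ℤˣ),
        (∀ σ ∈ galRange (K := ℚ) K₀, η σ = 1) → η ≠ 1 →
      ∀ (V : WeierstrassCurve ℚ) [V.IsElliptic] [V.IsGloballyMinimal] {N : ℕ} [NeZero N]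
        {f : CuspForm (Gamma0 N) 2}, V.HasCM →
        p ≠ 2 → V.HasGoodReductionAtPrime p → V.frobeniusTrace p = 0 → IsNewformOf V f →
      ∀ (ϖ : ℚ), (if Even (p / 2) then (ϖ : ℝ) * V.realPeriodRat = plusPeriod f
          else (ϖ : ℝ) * V.imaginaryPeriodRat = minusPeriod f) →
      ∀ (κ : ZpExtension ℚ p) (γ : absoluteGaloisGroup ℚ),
        κ.IsCyclotomic → κ.IsTopGenerator γ → γ ∈ galRange (K := ℚ) K₀ → IsCyclotomicVariable p γ →
      ∀ (Lp : IwasawaAlgebra p), IsQuadraticBranchPlusLFunction f p ϖ Lp →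
      ∀ D : EtaSignedSelmerDualData V κ K₀ ℚ_[p] η γ 1, D.charIdeal = Ideal.span {Lp}) :
    ∀ (W : WeierstrassCurve ℚ) [W.IsElliptic] [W.IsGloballyMinimal],
      HasSignedLocalType W p (.Istar 0) → W.analyticRank = 1 →
      ∀ (V : WeierstrassCurve ℚ) [V.IsElliptic] [V.IsGloballyMinimal] (C : VariableChange ℚ)
        {N : ℕ} [NeZero N] {f : CuspForm (Gamma0 N) 2},
        p ≠ 2 → C • W.quadraticTwist ((-1) ^ (p / 2) * p) = V →
        V.HasGoodReductionAtPrime p → V.frobeniusTrace p = 0 →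
        QuadraticBranchPlusMainConjectureAt V p → IsNewformOf V f →
        ∀ (ϖ : ℚ), (if Even (p / 2) then (ϖ : ℝ) * V.realPeriodRat = plusPeriod f
            else (ϖ : ℝ) * V.imaginaryPeriodRat = minusPeriod f) →
        ∀ (Lη : IwasawaAlgebra p), IsQuadraticBranchMinusLFunction f p ϖ Lη →
        ∀ (κ : ZpExtension ℚ p) (γ : Field.absoluteGaloisGroup ℚ),
          κ.IsCyclotomic → κ.IsTopGenerator γ → IsCyclotomicVariable p γ →
        ∀ (D : StrictSignedSelmerDualData W κ ℚ_[p] γ (-1)) (L' : IwasawaAlgebra p),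
          Lη = PowerSeries.X * L' → D.charIdeal = Ideal.span {L'} := by
  intro W _ _ hT _hr V _ _ C N _ f _ hCV hgood hap _h1 hf ϖ hϖ Lη hL κ γ hκ hγ hγc D L' hLL'
  haveI : NeZero p := ⟨(Fact.out : p.Prime).ne_zero⟩
  haveI : IsCyclotomicExtension {p} ℚ (CyclotomicField p ℚ) :=
    CyclotomicField.isCyclotomicExtension p ℚ
  haveI : (galRange (K := ℚ) (CyclotomicField p ℚ)).Normal := normal_galRange_cyclotomic p _
  obtain ⟨θ, ηθ, hθ, hc, hη, hηK, hη1⟩ := SignedTwist.exists_theta_eta_cyclotomicField p hp2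
  have hD := SignedTwist.localTowerHyp_padic p κ (CyclotomicField p ℚ) hκ
  have hκ₀ := kappa_surjOn_galRange_cyclotomic κ (CyclotomicField p ℚ)
  have hcop := coprime_index_galRange_cyclotomic p (CyclotomicField p ℚ)
  obtain ⟨γ', hγ'K, hγ'κ⟩ := hκ₀ (κ γ)
  have hγγ' : γ⁻¹ * γ' ∈ κ.kerSubgroup := by
    rw [ZpExtension.mem_kerSubgroup, map_mul, map_inv, hγ'κ, inv_mul_cancel]
  have hγ' : κ.IsTopGenerator γ' := by rw [ZpExtension.IsTopGenerator, hγ'κ]; exact hγ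
  have hγ'c : IsCyclotomicVariable p γ' :=
    SignedTwist.isCyclotomicVariable_of_inv_mul_mem_ker hκ hγγ' hγc
  have hCMV : V.HasCM := hasCM_of_smul_quadraticTwist_eq (Additive.pStar_ne_zero p) hCV hT.1
  have hEven := hC1K (CyclotomicField p ℚ) ηθ hηK hη1 V hCMV hp2 hgood hap hf ϖ hϖ κ γ' hκ hγ'
    hγ'K hγ'c
  have hOdd := (kobayashi74Text_of_fact p h74 (CyclotomicField p ℚ) ηθ hηK hη1 V hp2 hgood hap hf
    ϖ hϖ κ γ' hκ hγ' hγ'K hγ'c).mp hEven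
  have h := hOdd Lη hL
    (D.toEtaSigned W (CyclotomicField p ℚ) hθ hc p κ hCV ηθ hη ℚ_[p] hD hκ₀ hcop hγ'K hγγ') L' hLL'
  rwa [StrictSignedSelmerDualData.toEtaSigned_charIdeal] at h

/-- **Head `ExactReadingOnType` (guard `p ≠ 2`) at EVERY odd prime**, from the named fact Kobayashi
2003 Thm. 7.4 at `η` and (C1_η)-for-CM in the `K_∞`-form at every odd `p` (`hC1K`, guard `p ≠ 2`;
conjecture-grade, carried): the planner's D79 / D82 (b) head text verbatim — ONE head serving the
`p ≥ 5` readings item (restriction) and the `p = 3` child (instantiation). CONDITIONAL.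
[cite: Kobayashi2003, §4 (p. 8), Thm. 7.4 (p. 13)] [cite: PollackRubin2004, p. 448 (remark)] -/
theorem inertBadSignedBranches_oddHead_exactReading_of_kobayashi74_of_plusMCEtaK
    (h74 : Kobayashi2003.thm74_etaEvenMC_iff_etaOddMC)
    (hC1K : ∀ (p : ℕ) [Fact p.Prime], p ≠ 2 →
      ∀ (K₀ : Type) [Field K₀] [NumberField K₀] [IsCyclotomicExtension {p} ℚ K₀]
        [(galRange (K := ℚ) K₀).Normal] (η : absoluteGaloisGroup ℚ →* ℤˣ),
        (∀ σ ∈ galRange (K := ℚ) K₀, η σ = 1) → η ≠ 1 →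
      ∀ (V : WeierstrassCurve ℚ) [V.IsElliptic] [V.IsGloballyMinimal] {N : ℕ} [NeZero N]
        {f : CuspForm (Gamma0 N) 2}, V.HasCM →
        p ≠ 2 → V.HasGoodReductionAtPrime p → V.frobeniusTrace p = 0 → IsNewformOf V f →
      ∀ (ϖ : ℚ), (if Even (p / 2) then (ϖ : ℝ) * V.realPeriodRat = plusPeriod f
          else (ϖ : ℝ) * V.imaginaryPeriodRat = minusPeriod f) →
      ∀ (κ : ZpExtension ℚ p) (γ : absoluteGaloisGroup ℚ),
        κ.IsCyclotomic → κ.IsTopGenerator γ → γ ∈ galRange (K := ℚ) K₀ → IsCyclotomicVariable p γ →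
      ∀ (Lp : IwasawaAlgebra p), IsQuadraticBranchPlusLFunction f p ϖ Lp →
      ∀ D : EtaSignedSelmerDualData V κ K₀ ℚ_[p] η γ 1, D.charIdeal = Ideal.span {Lp}) :
    ∀ (p : ℕ) [Fact p.Prime], p ≠ 2 → ∀ (W : WeierstrassCurve ℚ) [W.IsElliptic]
      [W.IsGloballyMinimal], HasSignedLocalType W p (.Istar 0) → W.analyticRank = 1 →
      ∀ (V : WeierstrassCurve ℚ) [V.IsElliptic] [V.IsGloballyMinimal] (C : VariableChange ℚ)
        {N : ℕ} [NeZero N] {f : CuspForm (Gamma0 N) 2},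
        p ≠ 2 → C • W.quadraticTwist ((-1) ^ (p / 2) * p) = V →
        V.HasGoodReductionAtPrime p → V.frobeniusTrace p = 0 →
        QuadraticBranchPlusMainConjectureAt V p → IsNewformOf V f →
        ∀ (ϖ : ℚ), (if Even (p / 2) then (ϖ : ℝ) * V.realPeriodRat = plusPeriod f
            else (ϖ : ℝ) * V.imaginaryPeriodRat = minusPeriod f) →
        ∀ (Lη : IwasawaAlgebra p), IsQuadraticBranchMinusLFunction f p ϖ Lη →
        ∀ (κ : ZpExtension ℚ p) (γ : Field.absoluteGaloisGroup ℚ),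
          κ.IsCyclotomic → κ.IsTopGenerator γ → IsCyclotomicVariable p γ →
        ∀ (D : StrictSignedSelmerDualData W κ ℚ_[p] γ (-1)) (L' : IwasawaAlgebra p),
          Lη = PowerSeries.X * L' → D.charIdeal = Ideal.span {L'} :=
  fun p _ hp2 ↦
    inertBadSignedBranches_oddHead_exactReadingAt_of_kobayashi74_of_plusMCEtaK p hp2 h74 (hC1K p hp2)

/-! ## §2 The `p = 3` child modulo the law at `3`, (C1_η)@3 and published named facts -/

/-- **The `p = 3` readings binder `h₅` of the x1b / inert `p = 3` nodes FROM the named facts and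
(C1_η)@3 in its two verbatim forms** — (C1_η)@3 (`hC1₃`, `ℚ(√−3)`-subtower form, for every CM `V`
good at `3` with `3` inert) ∧, for every `W` of type `(3, I₀*)` with `r_an(W) = 1`, (R2)@3 (from KO18
Main Thm. 1.3 by name) ∧ the exact strict-minus reading at `3` (from Kob03 Thm. 7.4 (η) by name and
`hC1K₃` = the `K_∞`-form of (C1_η) at `p = 3` for CM `V`, period clause read at `p* = −3`:
imaginary period). Pure instantiation of §1 at `p = 3` (`(−1)^{⌊3/2⌋}·3 = −3`, `¬ Even (3/2)`).
CONDITIONAL. [cite: KitajimaOtsuki2018, Main Thm. 1.3] [cite: Kobayashi2003, Thm. 7.4 (p. 13)]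
[cite: PollackRubin2004, p. 448 (Theorem and remark)] -/
theorem inertBadSignedBranches_readingsAtThree_of_literature_of_plusMCEta
    (hKO : KitajimaOtsuki2018.mainThm13_etaSignedSelmerDual_noFiniteSubmodule)
    (h74 : Kobayashi2003.thm74_etaEvenMC_iff_etaOddMC)
    (hC1₃ : ∀ (V : WeierstrassCurve ℚ) [V.IsElliptic] [V.IsGloballyMinimal],
      V.HasCM → V.HasGoodReductionAtPrime 3 → CMInert V 3 → QuadraticBranchPlusMainConjectureAt V 3)
    (hC1K₃ : ∀ (K₀ : Type) [Field K₀] [NumberField K₀] [IsCyclotomicExtension {3} ℚ K₀]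
        [(galRange (K := ℚ) K₀).Normal] (η : absoluteGaloisGroup ℚ →* ℤˣ),
        (∀ σ ∈ galRange (K := ℚ) K₀, η σ = 1) → η ≠ 1 →
      ∀ (V : WeierstrassCurve ℚ) [V.IsElliptic] [V.IsGloballyMinimal] {N : ℕ} [NeZero N]
        {f : CuspForm (Gamma0 N) 2}, V.HasCM →
        (3 : ℕ) ≠ 2 → V.HasGoodReductionAtPrime 3 → V.frobeniusTrace 3 = 0 → IsNewformOf V f →
      ∀ (ϖ : ℚ), (ϖ : ℝ) * V.imaginaryPeriodRat = minusPeriod f →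
      ∀ (κ : ZpExtension ℚ 3) (γ : absoluteGaloisGroup ℚ),
        κ.IsCyclotomic → κ.IsTopGenerator γ → γ ∈ galRange (K := ℚ) K₀ → IsCyclotomicVariable 3 γ →
      ∀ (Lp : IwasawaAlgebra 3), IsQuadraticBranchPlusLFunction f 3 ϖ Lp →
      ∀ D : EtaSignedSelmerDualData V κ K₀ ℚ_[3] η γ 1, D.charIdeal = Ideal.span {Lp}) :
    (∀ (V : WeierstrassCurve ℚ) [V.IsElliptic] [V.IsGloballyMinimal], V.HasCM →
        V.HasGoodReductionAtPrime 3 → CMInert V 3 → QuadraticBranchPlusMainConjectureAt V 3) ∧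
      ∀ (W : WeierstrassCurve ℚ) [W.IsElliptic] [W.IsGloballyMinimal],
        HasSignedLocalType W 3 (.Istar 0) → W.analyticRank = 1 →
        OddBranchStrictMinusNoFiniteSubmoduleAt W 3 ∧
        ∀ (V : WeierstrassCurve ℚ) [V.IsElliptic] [V.IsGloballyMinimal] (C : VariableChange ℚ)
          {N : ℕ} [NeZero N] {f : CuspForm (Gamma0 N) 2},
          (3 : ℕ) ≠ 2 → C • W.quadraticTwist (-3) = V →
          V.HasGoodReductionAtPrime 3 → V.frobeniusTrace 3 = 0 →
          QuadraticBranchPlusMainConjectureAt V 3 → IsNewformOf V f →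
          ∀ (ϖ : ℚ), (ϖ : ℝ) * V.imaginaryPeriodRat = minusPeriod f →
          ∀ (Lη : IwasawaAlgebra 3), IsQuadraticBranchMinusLFunction f 3 ϖ Lη →
          ∀ (κ : ZpExtension ℚ 3) (γ : Field.absoluteGaloisGroup ℚ),
            κ.IsCyclotomic → κ.IsTopGenerator γ → IsCyclotomicVariable 3 γ →
          ∀ (D : StrictSignedSelmerDualData W κ ℚ_[3] γ (-1)) (L' : IwasawaAlgebra 3),
            Lη = PowerSeries.X * L' → D.charIdeal = Ideal.span {L'} := by
  have h32 : ((-1 : ℚ) ^ (3 / 2) * (3 : ℕ)) = -3 := by norm_num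
  have hodd : ¬ Even (3 / 2) := by decide
  have h3 := inertBadSignedBranches_oddHead_exactReadingAt_of_kobayashi74_of_plusMCEtaK 3 (by decide)
    h74 (fun K₀ _ _ _ _ η hηK hη1 V _ _ N _ f hCM hp2 hgood hap hf ϖ hϖ κ γ hκ hγ hγK hγc Lp hLp D ↦ by
      rw [if_neg hodd] at hϖ
      exact hC1K₃ K₀ η hηK hη1 V hCM hp2 hgood hap hf ϖ hϖ κ γ hκ hγ hγK hγc Lp hLp D)
  refine ⟨hC1₃, fun W _ _ hT hr ↦ ⟨?_, ?_⟩⟩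
  · exact inertBadSignedBranches_oddHead_noFiniteSubmodule_of_kitajimaOtsuki13 hKO 3 (by decide) W hT hr
  · intro V _ _ C N _ f hp2 hC hgood hap hC1 hf ϖ hϖ Lη hL κ γ hκ hγ hγc D L' hLL'
    rw [← h32] at hC
    exact h3 W hT hr V C hp2 hC hgood hap hC1 hf ϖ (by rw [if_neg hodd]; exact hϖ) Lη hL κ γ hκ hγ
      hγc D L' hLL'

/-- **THE D71 CHILD `InertBadAtThreeIstarZero` MODULO C-cc-1@3 (pair/LEVEL normal form) ∧ (C1_η)@3
[two verbatim forms] ∧ the NAMED facts Kitajima–Otsuki 2018 Main Thm. 1.3 and Kobayashi 2003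
Thm. 7.4 (η) ∧ the route's support item `PublishedFactsInert`.** `hlaw₃` = the route crux
`CccOneLawOnTypeIstarZero`'s unfolded body READ AT `3` in the `+ δ`-free normal form of record
(`ord₃ c₃(W) = 0` inlined; NIT-K8P3-2) — the ONE input with no print behind it (the crux content at
`3`); `hC1₃` / `hC1K₃` = (C1_η)@3 for CM good-inert `V` in the `ℚ(√−3)`-subtower form and in
Kobayashi's `K_∞`-form (Pollack–Rubin's p. 448 remark, `p > 2`; conjecture-grade, carried); `hKO` /
`h74` = the two named Literature facts; `h₆` = `PublishedFactsInert` verbatim. Composition of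
`inertBadSignedBranches_readingsAtThree_of_literature_of_plusMCEta` with x1b's
`inertBadSignedBranches_inertBadAtThreeIstarZero_of_pairLawAtThree_of_readingsAtThree` (p415789).
CONDITIONAL on every displayed hypothesis; the item stays OPEN; nothing booked.
[cite: Kobayashi2003, §4 (p. 8), Thm. 7.4 (p. 13)] [cite: KitajimaOtsuki2018, Main Thm. 1.3]
[cite: PollackRubin2004, p. 448 (remark)] [cite: Mazur1978, Cor. 4.1]
[cite: SilvermanATAEC1994, IV.9.4 and Table 4.1] [cite: Miller2011LMS, §1 and Def. 1.1] -/
theorem inertBadSignedBranches_inertBadAtThreeIstarZero_of_pairLawAtThree_of_literature_of_plusMCEta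
    (hlaw₃ : ∀ (W : WeierstrassCurve ℚ) [W.IsElliptic] [W.IsGloballyMinimal],
      HasSignedLocalType W 3 (.Istar 0) → W.analyticRank = 1 →
      ∀ (V : WeierstrassCurve ℚ) [V.IsElliptic] [V.IsGloballyMinimal] (C : VariableChange ℚ)
        {N : ℕ} [NeZero N] {f : CuspForm (Gamma0 N) 2},
        C • W.quadraticTwist (-3) = V →
        V.HasGoodReductionAtPrime 3 → V.frobeniusTrace 3 = 0 → IsNewformOf V f →
        ∀ (ϖ : ℚ), (ϖ : ℝ) * V.imaginaryPeriodRat = minusPeriod f →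
        ∀ (L : IwasawaAlgebra 3), IsQuadraticBranchMinusLFunction f 3 ϖ L →
        (∀ Q : (W.baseChange ℚ_[3]).toAffine.Point, 3 • Q = 0 → Q = 0) →
        ∀ (P : W.toAffine.Point) (n : ℕ), ¬ IsOfFinAddOrder P →
        (∀ R : W.toAffine.Point, ∃ (k : ℤ) (T : W.toAffine.Point), IsOfFinAddOrder T ∧ R = k • P + T) →
        (∃ Q : (W.baseChange ℚ_[3]).toAffine.Point, 3 ^ n • Q = W.toPadicPoint 3 P) →
        (∀ Q : (W.baseChange ℚ_[3]).toAffine.Point, 3 ^ (n + 1) • Q ≠ W.toPadicPoint 3 P) →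
        ∀ (q : ℚ), shaAn W = (q : ℂ) →
        PowerSeries.coeff 1 L ≠ 0 ∧
          ((PowerSeries.coeff 1 L : ℤ_[3]) : ℚ_[3]).valuation =
            2 * (n : ℤ) + padicValRat 3 (q * W.tamagawaProduct / (W.torsionOrder : ℚ) ^ 2))
    (hC1₃ : ∀ (V : WeierstrassCurve ℚ) [V.IsElliptic] [V.IsGloballyMinimal],
      V.HasCM → V.HasGoodReductionAtPrime 3 → CMInert V 3 → QuadraticBranchPlusMainConjectureAt V 3)
    (hC1K₃ : ∀ (K₀ : Type) [Field K₀] [NumberField K₀] [IsCyclotomicExtension {3} ℚ K₀]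
        [(galRange (K := ℚ) K₀).Normal] (η : absoluteGaloisGroup ℚ →* ℤˣ),
        (∀ σ ∈ galRange (K := ℚ) K₀, η σ = 1) → η ≠ 1 →
      ∀ (V : WeierstrassCurve ℚ) [V.IsElliptic] [V.IsGloballyMinimal] {N : ℕ} [NeZero N]
        {f : CuspForm (Gamma0 N) 2}, V.HasCM →
        (3 : ℕ) ≠ 2 → V.HasGoodReductionAtPrime 3 → V.frobeniusTrace 3 = 0 → IsNewformOf V f →
      ∀ (ϖ : ℚ), (ϖ : ℝ) * V.imaginaryPeriodRat = minusPeriod f →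
      ∀ (κ : ZpExtension ℚ 3) (γ : absoluteGaloisGroup ℚ),
        κ.IsCyclotomic → κ.IsTopGenerator γ → γ ∈ galRange (K := ℚ) K₀ → IsCyclotomicVariable 3 γ →
      ∀ (Lp : IwasawaAlgebra 3), IsQuadraticBranchPlusLFunction f 3 ϖ Lp →
      ∀ D : EtaSignedSelmerDualData V κ K₀ ℚ_[3] η γ 1, D.charIdeal = Ideal.span {Lp})
    (hKO : KitajimaOtsuki2018.mainThm13_etaSignedSelmerDual_noFiniteSubmodule)
    (h74 : Kobayashi2003.thm74_etaEvenMC_iff_etaOddMC) (h₆ : PublishedFactsInert) :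
    Summit.BirchSwinnertonDyer.BirchSwinnertonDyer.Theses.InertBadSignedBranches.InertBadAtThreeIstarZero := by
  unfold Summit.BirchSwinnertonDyer.BirchSwinnertonDyer.Theses.InertBadSignedBranches.InertBadAtThreeIstarZero
  intro W _ _ _ hT hr
  exact inertBadSignedBranches_inertBadAtThreeIstarZero_of_pairLawAtThree_of_readingsAtThree hlaw₃
    (inertBadSignedBranches_readingsAtThree_of_literature_of_plusMCEta hKO h74 hC1₃ hC1K₃) h₆ W hT hr

/-- **THE D71 CHILD `InertBadAtThreeIstarZero` MODULO (GZ_η-VAL)@3 (print/LOG normal form) ∧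
(C1_η)@3 [two verbatim forms] ∧ the NAMED facts KO18 Main Thm. 1.3 and Kob03 Thm. 7.4 (η) ∧
`PublishedFactsInert`** — the same with the law displayed in print currency: `hGZη₃` =
`coeff₁ L ≠ 0 ∧ v₃(coeff₁ L) = 2·ord₃ log_ω(P) + ord₃(L′(W,1)/(Ω_W·Reg W))` on the type (the cell's
own statement, PAPER from (GZ_η)@3 by memo N21 v1.2 — NO print; a HYPOTHESIS). Composition with
x1b's `inertBadSignedBranches_inertBadAtThreeIstarZero_of_etaGZValuationAtThree_of_readingsAtThree`.
CONDITIONAL on every displayed hypothesis; the item stays OPEN; nothing booked.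
[cite: Kobayashi2003, §4 (p. 8), Thm. 7.4 (p. 13)] [cite: KitajimaOtsuki2018, Main Thm. 1.3]
[cite: PollackRubin2004, p. 448 (remark)] [cite: Mazur1978, Cor. 4.1]
[cite: SilvermanAEC2009, IV.6.4 and VII.6.3] [cite: SilvermanATAEC1994, IV.9.4 and Table 4.1]
[cite: Miller2011LMS, §1 and Def. 1.1] -/
theorem inertBadSignedBranches_inertBadAtThreeIstarZero_of_etaGZValuationAtThree_of_literature_of_plusMCEta
    (hGZη₃ : ∀ (W : WeierstrassCurve ℚ) [W.IsElliptic] [W.IsGloballyMinimal],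
      HasSignedLocalType W 3 (.Istar 0) → W.analyticRank = 1 →
      ∀ (V : WeierstrassCurve ℚ) [V.IsElliptic] [V.IsGloballyMinimal] (C : VariableChange ℚ)
        {N : ℕ} [NeZero N] {f : CuspForm (Gamma0 N) 2},
        C • W.quadraticTwist (-3) = V →
        V.HasGoodReductionAtPrime 3 → V.frobeniusTrace 3 = 0 → IsNewformOf V f →
        ∀ (ϖ : ℚ), (ϖ : ℝ) * V.imaginaryPeriodRat = minusPeriod f →
        ∀ (L : IwasawaAlgebra 3), IsQuadraticBranchMinusLFunction f 3 ϖ L →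
        ∀ (P : W.toAffine.Point), ¬ IsOfFinAddOrder P →
        (∀ R : W.toAffine.Point, ∃ (k : ℤ) (T : W.toAffine.Point), IsOfFinAddOrder T ∧ R = k • P + T) →
        ∀ (q : ℚ), W.leadingLCoeff / ((W.realPeriodRat * W.regulator : ℝ) : ℂ) = (q : ℂ) →
        PowerSeries.coeff 1 L ≠ 0 ∧
          ((PowerSeries.coeff 1 L : ℤ_[3]) : ℚ_[3]).valuation =
            2 * (padicLog (W.baseChange ℚ_[3]) (W.toPadicPoint 3 P)).valuation + padicValRat 3 q)
    (hC1₃ : ∀ (V : WeierstrassCurve ℚ) [V.IsElliptic] [V.IsGloballyMinimal],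
      V.HasCM → V.HasGoodReductionAtPrime 3 → CMInert V 3 → QuadraticBranchPlusMainConjectureAt V 3)
    (hC1K₃ : ∀ (K₀ : Type) [Field K₀] [NumberField K₀] [IsCyclotomicExtension {3} ℚ K₀]
        [(galRange (K := ℚ) K₀).Normal] (η : absoluteGaloisGroup ℚ →* ℤˣ),
        (∀ σ ∈ galRange (K := ℚ) K₀, η σ = 1) → η ≠ 1 →
      ∀ (V : WeierstrassCurve ℚ) [V.IsElliptic] [V.IsGloballyMinimal] {N : ℕ} [NeZero N]
        {f : CuspForm (Gamma0 N) 2}, V.HasCM →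
        (3 : ℕ) ≠ 2 → V.HasGoodReductionAtPrime 3 → V.frobeniusTrace 3 = 0 → IsNewformOf V f →
      ∀ (ϖ : ℚ), (ϖ : ℝ) * V.imaginaryPeriodRat = minusPeriod f →
      ∀ (κ : ZpExtension ℚ 3) (γ : absoluteGaloisGroup ℚ),
        κ.IsCyclotomic → κ.IsTopGenerator γ → γ ∈ galRange (K := ℚ) K₀ → IsCyclotomicVariable 3 γ →
      ∀ (Lp : IwasawaAlgebra 3), IsQuadraticBranchPlusLFunction f 3 ϖ Lp →
      ∀ D : EtaSignedSelmerDualData V κ K₀ ℚ_[3] η γ 1, D.charIdeal = Ideal.span {Lp})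
    (hKO : KitajimaOtsuki2018.mainThm13_etaSignedSelmerDual_noFiniteSubmodule)
    (h74 : Kobayashi2003.thm74_etaEvenMC_iff_etaOddMC) (h₆ : PublishedFactsInert) :
    Summit.BirchSwinnertonDyer.BirchSwinnertonDyer.Theses.InertBadSignedBranches.InertBadAtThreeIstarZero := by
  unfold Summit.BirchSwinnertonDyer.BirchSwinnertonDyer.Theses.InertBadSignedBranches.InertBadAtThreeIstarZero
  intro W _ _ _ hT hr
  exact inertBadSignedBranches_inertBadAtThreeIstarZero_of_etaGZValuationAtThree_of_readingsAtThree hGZη₃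
    (inertBadSignedBranches_readingsAtThree_of_literature_of_plusMCEta hKO h74 hC1₃ hC1K₃) h₆ W hT hr

/-- **Gen 0's odd-heads reduction with the two PRINT heads discharged by name**: THE CHILD ⟸
C-cc-1@3 (pair/LEVEL form) ∧ head 1 = (C1_η) for CM good-inert `V` at every odd `p` (`h1`,
`ℚ(√p*)`-form, guard `p ≠ 2`) ∧ its `K_∞`-form companion `hC1K` (guard `p ≠ 2`) ∧ the named facts
KO18 Main Thm. 1.3 / Kob03 Thm. 7.4 (η) ∧ `PublishedFactsInert` — i.e.
`inertBadSignedBranches_inertBadAtThreeIstarZero_of_pairLawAtThree_of_oddHeads` (p418240) with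
`h2 := §1 (KO18)` and `h3 := §1 (Kob03 7.4 + hC1K)`. Of the planner's three D79 / D82 (b) heads only
the conjecture-grade (C1_η) head (in two verbatim forms) remains displayed. CONDITIONAL; the item
stays OPEN; nothing booked. [cite: Kobayashi2003, §4 (p. 8), Thm. 7.4 (p. 13)]
[cite: KitajimaOtsuki2018, Main Thm. 1.3] [cite: PollackRubin2004, p. 448 (remark)]
[cite: Mazur1978, Cor. 4.1] [cite: Miller2011LMS, §1 and Def. 1.1] -/
theorem inertBadSignedBranches_inertBadAtThreeIstarZero_of_pairLawAtThree_of_oddPlusMCEta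
    (hlaw₃ : ∀ (W : WeierstrassCurve ℚ) [W.IsElliptic] [W.IsGloballyMinimal],
      HasSignedLocalType W 3 (.Istar 0) → W.analyticRank = 1 →
      ∀ (V : WeierstrassCurve ℚ) [V.IsElliptic] [V.IsGloballyMinimal] (C : VariableChange ℚ)
        {N : ℕ} [NeZero N] {f : CuspForm (Gamma0 N) 2},
        C • W.quadraticTwist (-3) = V →
        V.HasGoodReductionAtPrime 3 → V.frobeniusTrace 3 = 0 → IsNewformOf V f →
        ∀ (ϖ : ℚ), (ϖ : ℝ) * V.imaginaryPeriodRat = minusPeriod f →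
        ∀ (L : IwasawaAlgebra 3), IsQuadraticBranchMinusLFunction f 3 ϖ L →
        (∀ Q : (W.baseChange ℚ_[3]).toAffine.Point, 3 • Q = 0 → Q = 0) →
        ∀ (P : W.toAffine.Point) (n : ℕ), ¬ IsOfFinAddOrder P →
        (∀ R : W.toAffine.Point, ∃ (k : ℤ) (T : W.toAffine.Point), IsOfFinAddOrder T ∧ R = k • P + T) →
        (∃ Q : (W.baseChange ℚ_[3]).toAffine.Point, 3 ^ n • Q = W.toPadicPoint 3 P) →
        (∀ Q : (W.baseChange ℚ_[3]).toAffine.Point, 3 ^ (n + 1) • Q ≠ W.toPadicPoint 3 P) →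
        ∀ (q : ℚ), shaAn W = (q : ℂ) →
        PowerSeries.coeff 1 L ≠ 0 ∧
          ((PowerSeries.coeff 1 L : ℤ_[3]) : ℚ_[3]).valuation =
            2 * (n : ℤ) + padicValRat 3 (q * W.tamagawaProduct / (W.torsionOrder : ℚ) ^ 2))
    (h1 : ∀ (p : ℕ) [Fact p.Prime], p ≠ 2 → ∀ (V : WeierstrassCurve ℚ) [V.IsElliptic]
      [V.IsGloballyMinimal], V.HasCM → V.HasGoodReductionAtPrime p → CMInert V p →
      QuadraticBranchPlusMainConjectureAt V p)
    (hC1K : ∀ (p : ℕ) [Fact p.Prime], p ≠ 2 →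
      ∀ (K₀ : Type) [Field K₀] [NumberField K₀] [IsCyclotomicExtension {p} ℚ K₀]
        [(galRange (K := ℚ) K₀).Normal] (η : absoluteGaloisGroup ℚ →* ℤˣ),
        (∀ σ ∈ galRange (K := ℚ) K₀, η σ = 1) → η ≠ 1 →
      ∀ (V : WeierstrassCurve ℚ) [V.IsElliptic] [V.IsGloballyMinimal] {N : ℕ} [NeZero N]
        {f : CuspForm (Gamma0 N) 2}, V.HasCM →
        p ≠ 2 → V.HasGoodReductionAtPrime p → V.frobeniusTrace p = 0 → IsNewformOf V f →
      ∀ (ϖ : ℚ), (if Even (p / 2) then (ϖ : ℝ) * V.realPeriodRat = plusPeriod f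
          else (ϖ : ℝ) * V.imaginaryPeriodRat = minusPeriod f) →
      ∀ (κ : ZpExtension ℚ p) (γ : absoluteGaloisGroup ℚ),
        κ.IsCyclotomic → κ.IsTopGenerator γ → γ ∈ galRange (K := ℚ) K₀ → IsCyclotomicVariable p γ →
      ∀ (Lp : IwasawaAlgebra p), IsQuadraticBranchPlusLFunction f p ϖ Lp →
      ∀ D : EtaSignedSelmerDualData V κ K₀ ℚ_[p] η γ 1, D.charIdeal = Ideal.span {Lp})
    (hKO : KitajimaOtsuki2018.mainThm13_etaSignedSelmerDual_noFiniteSubmodule)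
    (h74 : Kobayashi2003.thm74_etaEvenMC_iff_etaOddMC) (h₆ : PublishedFactsInert) :
    Summit.BirchSwinnertonDyer.BirchSwinnertonDyer.Theses.InertBadSignedBranches.InertBadAtThreeIstarZero :=
  inertBadSignedBranches_inertBadAtThreeIstarZero_of_pairLawAtThree_of_oddHeads hlaw₃ h1
    (inertBadSignedBranches_oddHead_noFiniteSubmodule_of_kitajimaOtsuki13 hKO)
    (inertBadSignedBranches_oddHead_exactReading_of_kobayashi74_of_plusMCEtaK h74 hC1K) h₆

end Summit.BirchSwinnertonDyer.BirchSwinnertonDyer.Theorems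
end
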